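import Mathlib.Probability.Process.LocalProperty
import Mathlib.Probability.Martingale.Basic
import Mathlib.Probability.Process.Stopping
import Mathlib.Probability.Process.Adapted
import Mathlib.Analysis.Calculus.IteratedDeriv.Defs
import Mathlib.Analysis.Calculus.ContDiff.Defs
import Mathlib.MeasureTheory.Integral.Bochner.Basic
import Mathlib.MeasureTheory.Integral.Lebesgue.Basic
import Mathlib.MeasureTheory.Measure.Lebesgue.Basic
import Mathlib.Data.List.Sort
import Literature.Probability.Process.BrownianMotion
import Literature.Probability.RandomPlanarGeometry.LocalMartingale
import HarnessLib

-- provenance: harness21/H21/H21/Prelude/Stoch/ItoCalculus.lean @ 7fbbdec (interim HEAD d8f2665); M5 mechanical rewrite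
/-!
# Itô calculus with respect to Brownian motion: interface layer (Stoch trunk, prelude C13)

This file is an *interface-level* formalisation of the Itô stochastic integral with respect to
the canonical Brownian motion `Literature.Probability.Process.brownian` (prelude C2) and its natural filtration
`Literature.Probability.RandomPlanarGeometry.brownianFiltration` (prelude C3). Nothing is constructed: we give

* the hypothesis structure `Literature.HasQuadraticVariation X A 𝓕 P` (`A` is an adapted, a.s.
  continuous increasing process with `A 0 = 0` and `X² - A` a local martingale);
* bounded **simple (elementary) processes** `Literature.SimpleProcess m 𝓕` (a strictly increasing
  finite list of deterministic times `t₀ < t₁ < ⋯ < tₖ` and bounded `𝓕 tᵢ`-measurable values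
  `value i` on `(tᵢ, tᵢ₊₁]`), their realisation as a process `SimpleProcess.toProcess` and their
  elementary stochastic integral `SimpleProcess.integral H B` against any process `B`
  (a finite Riemann–Stieltjes sum; a real definition);
* the two modes of convergence of the theory: `Literature.Probability.Process.TendstoUCP` (uniformly on compacts in
  probability) and `Literature.Probability.Process.SimpleProcess.IsApproxSeq` (`∫₀ᵗ (Hₙ - H)² ds → 0` in probability for
  every `t`);
* the characterising predicate `Literature.IsItoIntegral H B J 𝓕 P`: `J` is a continuous local
  martingale vanishing at `0`, `H` admits simple approximants, and along *every* sequence of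
  simple approximants the elementary integrals against `B` converge to `J` u.c.p.;
* the classical theorems as sorried statements: the Itô isometry for simple integrands,
  existence and uniqueness (up to indistinguishability) of the Itô integral of a progressive
  integrand with `∫₀ᵗ H² ds < ∞` a.s., `⟨B⟩ₜ = t`, Itô's formula for `C²` functions of Brownian
  motion, and Lévy's characterisation of Brownian motion.

## Mathlib status

Mathlib (pinned commit) has filtrations, `Adapted` / `StronglyAdapted`, progressive
measurability (`MeasureTheory.IsStronglyProgressive`, formerly `ProgMeasurable`), stopping
times, stopped processes, martingales, the `Locally` combinator and the Brownian predicates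
`IsPreBrownianReal` / `IsBrownianReal`, but no quadratic variation, no elementary/simple
predictable processes and no stochastic integral of any kind. Everything below is therefore new;
all structural notions used are Mathlib's (plus our `Literature.Probability.RandomPlanarGeometry.IsLocalMartingale`).

## Design choices

* Time integrals `∫₀ᵗ … ds` are written as integrals over `Set.Icc (0 : ℝ) t` for the Lebesgue
  measure on `ℝ`, composing the integrand with `Real.toNNReal` (Mathlib has no `MeasureSpace`
  instance on `ℝ≥0`).
* The approximation condition in `IsItoIntegral` is *convergence in probability* of the pathwise
  extended integral `∫⁻ s ∈ [0, t], (Hₙ - H)²` rather than convergence in `L²(ds ⊗ P)`: this is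
  the mode adapted to integrands that are only a.s. locally square integrable
  (Revuz–Yor, Ch. IV, Prop. (2.13) / Def. (2.9) for `L²_loc(B)`), and using `∫⁻` avoids the
  Bochner junk value `0` for non-integrable functions, which would make the hypothesis vacuously
  satisfiable. The u.c.p. convergence `TendstoUCP` is phrased as
  `P {ω | ∃ s ≤ t, ε ≤ |Yₙ s ω - J s ω|} → 0`, avoiding a real-valued `iSup` (junk value `0` on
  unbounded sets).
* `IsItoIntegral` *includes* the existence of one approximating sequence, so that uniqueness up
  to indistinguishability (`IsItoIntegral.unique`) holds with no side condition on `H`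
  (u.c.p. limits of a fixed sequence are indistinguishable when a.s. continuous).
* The predicate takes the integrator `B` as a parameter but measures approximation in `ds`; it is
  the right notion exactly when `⟨B⟩ₜ = t`, i.e. for Brownian motion, which is the only case the
  theorems below address.
* `SimpleProcess` uses deterministic times and a `List`; indices out of range are read with
  `List.getD … 0`, so all definitions are total. Since consecutive intervals `(tᵢ, tᵢ₊₁]` are
  disjoint, `toProcess` is written as a finite sum of indicators.
* We work with the raw natural filtration `brownianFiltration` (neither completed nor made
  right-continuous), as fixed in prelude C3; the existence theorem `exists_isItoIntegral` asserts
  an a.s.-continuous version adapted to it (Revuz–Yor work under the usual conditions; the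
  statement for the raw filtration follows by choosing versions, cf. Kallenberg Lemma 7.8 —
  label uncertain, marked '?').

## References

* K. Itô, *Stochastic integral*, Proc. Imp. Acad. Tokyo 20 (1944), 519–524.
* D. Revuz, M. Yor, *Continuous Martingales and Brownian Motion* (3rd ed., 1999), Ch. IV §§1–3
  (quadratic variation, stochastic integrals, Itô's formula, Lévy's characterisation
  Thm (3.6)).
* O. Kallenberg, *Foundations of Modern Probability* (2nd ed., 2002), Ch. 17–18.
* Coelho, arXiv:2606.15089 (Lean formalisation of stochastic integration; labels marked '?'
  are uncertain).
-/

open MeasureTheory ProbabilityTheory Filter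
open scoped NNReal ENNReal Topology

namespace Literature.Probability.Process

variable {Ω : Type*} {m : MeasurableSpace Ω}

/-! ### Quadratic variation as a hypothesis structure -/

/-- `HasQuadraticVariation X A 𝓕 P`: the process `A` is (a version of) the **quadratic
variation** `⟨X⟩` of the real process `X` with respect to the filtration `𝓕` and the measure
`P`, characterised à la Doob–Meyer: `A` is `𝓕`-adapted, has a.s. continuous and monotone paths,
starts at `0`, and `X² - A` is a local martingale. For a continuous local martingale `X` such an
`A` exists and is unique up to indistinguishability (Revuz–Yor, Ch. IV, Thm (1.8)); here it is a
hypothesis structure only.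
Revuz–Yor, *Continuous Martingales and Brownian Motion* (1999), Ch. IV, Thm (1.8) and
Def. (1.9). [folklore] -/
structure HasQuadraticVariation (X A : ℝ≥0 → Ω → ℝ) (𝓕 : Filtration ℝ≥0 m) (P : Measure Ω) :
    Prop where
  /-- The quadratic variation process is adapted. -/
  adapted : Adapted 𝓕 A
  /-- Almost every path of the quadratic variation is continuous. -/
  continuous : ∀ᵐ ω ∂P, Continuous (A · ω)
  /-- Almost every path of the quadratic variation is nondecreasing. -/
  monotone : ∀ᵐ ω ∂P, Monotone (A · ω)
  /-- The quadratic variation vanishes at time `0`. -/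
  zero : ∀ ω, A 0 ω = 0
  /-- `X² - A` is a local martingale. -/
  isLocalMartingale : RandomPlanarGeometry.IsLocalMartingale (fun t ω ↦ X t ω ^ 2 - A t ω) 𝓕 P

/-! ### Simple (elementary) integrands and their elementary integral -/

/-- A bounded **simple (elementary) process** for the filtration `𝓕` on `(Ω, m)`: a strictly
increasing finite list of deterministic times `t₀ < t₁ < ⋯ < tₖ` and, for each `i`, a real
random variable `value i` which is `𝓕 tᵢ`-(strongly) measurable, all uniformly bounded by one
constant. It represents the left-continuous adapted step process
`H = ∑ᵢ value i · 𝟙_{(tᵢ, tᵢ₊₁]}` (`SimpleProcess.toProcess`). Values `value i` for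
`i + 1 ≥ length` are carried but never used.
Revuz–Yor, *Continuous Martingales and Brownian Motion* (1999), Ch. IV, Def. (2.3)
(elementary processes `ℰ`). [folklore] -/
structure SimpleProcess (m : MeasurableSpace Ω) (𝓕 : Filtration ℝ≥0 m) where
  /-- The deterministic partition times `t₀ < t₁ < ⋯ < tₖ`. -/
  times : List ℝ≥0
  /-- The times are strictly increasing (Mathlib's `List.SortedLT`). -/
  sorted : times.SortedLT
  /-- The value of the process on the interval `(tᵢ, tᵢ₊₁]`. -/
  value : ℕ → Ω → ℝ
  /-- The value on `(tᵢ, tᵢ₊₁]` is `𝓕 tᵢ`-measurable. -/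
  measurable : ∀ i, ∀ h : i < times.length, StronglyMeasurable[𝓕 (times.get ⟨i, h⟩)] (value i)
  /-- The values are uniformly bounded. -/
  bounded : ∃ C : ℝ, ∀ i ω, |value i ω| ≤ C

namespace SimpleProcess

variable {𝓕 : Filtration ℝ≥0 m}

/-- The `i`-th partition time of a simple process, read totally (`0` if `i` is out of range).
Revuz–Yor, *Continuous Martingales and Brownian Motion* (1999), Ch. IV, Def. (2.3). [folklore] -/
def time (H : SimpleProcess m 𝓕) (i : ℕ) : ℝ≥0 :=
  H.times.getD i 0

/-- The step process `(t, ω) ↦ ∑ᵢ value i ω · 𝟙_{(tᵢ, tᵢ₊₁]}(t)` represented by a simple process: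
equal to `value i ω` for `t ∈ (tᵢ, tᵢ₊₁]` (the intervals are pairwise disjoint since the times
are strictly increasing) and to `0` for `t ≤ t₀` or `t > tₖ`.
Revuz–Yor, *Continuous Martingales and Brownian Motion* (1999), Ch. IV, Def. (2.3). [folklore] -/
noncomputable def toProcess (H : SimpleProcess m 𝓕) : ℝ≥0 → Ω → ℝ :=
  fun t ω ↦ ∑ i ∈ Finset.range (H.times.length - 1),
    (Set.Ioc (H.time i) (H.time (i + 1))).indicator (fun _ ↦ H.value i ω) t

/-- The **elementary stochastic integral** of a simple process `H` against a process `B`,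
as a process: `(H · B)_t = ∑ᵢ value i · (B_{t ∧ tᵢ₊₁} - B_{t ∧ tᵢ})` (a finite
Riemann–Stieltjes sum; no probability is involved in the definition).
Itô (1944); Revuz–Yor, *Continuous Martingales and Brownian Motion* (1999), Ch. IV, (2.4). [cite: Ito1944] -/
def integral (H : SimpleProcess m 𝓕) (B : ℝ≥0 → Ω → ℝ) : ℝ≥0 → Ω → ℝ :=
  fun t ω ↦ ∑ i ∈ Finset.range (H.times.length - 1),
    H.value i ω * (B (min t (H.time (i + 1))) ω - B (min t (H.time i)) ω)

/-- The elementary integral vanishes at time `0`.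
Revuz–Yor, *Continuous Martingales and Brownian Motion* (1999), Ch. IV, (2.4). [folklore] -/
@[simp]
theorem integral_zero (H : SimpleProcess m 𝓕) (B : ℝ≥0 → Ω → ℝ) (ω : Ω) :
    H.integral B 0 ω = 0 := by
  simp [integral]

/-- A sequence `Hn` of simple processes **approximates** the integrand `H : ℝ≥0 → Ω → ℝ`
(in `L²_loc(ds)` in probability) under `P` if for every `t` and every `ε > 0`,
`P (∫₀ᵗ (Hₙ(s) - H(s))² ds ≥ ε) → 0` as `n → ∞`. The time integral is the extended Lebesgue
integral over `[0, t] ⊆ ℝ`.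
Revuz–Yor, *Continuous Martingales and Brownian Motion* (1999), Ch. IV, Def. (2.9) and
Prop. (2.13). [folklore] -/
def IsApproxSeq (Hn : ℕ → SimpleProcess m 𝓕) (H : ℝ≥0 → Ω → ℝ) (P : Measure Ω) : Prop :=
  ∀ (t : ℝ≥0) (ε : ℝ), 0 < ε →
    Tendsto (fun n ↦ P {ω | ENNReal.ofReal ε ≤
      ∫⁻ s in Set.Icc (0 : ℝ) t,
        ENNReal.ofReal (((Hn n).toProcess s.toNNReal ω - H s.toNNReal ω) ^ 2)})
      atTop (𝓝 0)

end SimpleProcess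

/-! ### The characterising predicate of the Itô integral -/

/-- **Convergence uniformly on compacts in probability** (u.c.p.) of a sequence of processes
`Y n` to a process `J` under `P`: for every `t` and `ε > 0`,
`P (∃ s ≤ t, |Yₙ s - J s| ≥ ε) → 0` as `n → ∞`.
Revuz–Yor, *Continuous Martingales and Brownian Motion* (1999), Ch. IV, Prop. (2.13);
P. Protter, *Stochastic Integration and Differential Equations* (2004), Ch. II §4. [folklore] -/
def TendstoUCP (Y : ℕ → ℝ≥0 → Ω → ℝ) (J : ℝ≥0 → Ω → ℝ) (P : Measure Ω) : Prop :=
  ∀ (t : ℝ≥0) (ε : ℝ), 0 < ε →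
    Tendsto (fun n ↦ P {ω | ∃ s ≤ t, ε ≤ |Y n s ω - J s ω|}) atTop (𝓝 0)

/-- `IsItoIntegral H B J 𝓕 P`: the process `J` **is the Itô integral** `∫₀ H dB` of the
integrand `H` against `B` (w.r.t. `𝓕`, `P`). Characterisation, not construction: `J` vanishes
at time `0`, has a.s. continuous paths and is a local martingale; `H` admits at least one
approximating sequence of bounded simple processes (`SimpleProcess.IsApproxSeq`); and along
*every* such sequence the elementary integrals `(Hₙ · B)` converge to `J` uniformly on compacts
in probability. Designed for `B` a Brownian motion (`⟨B⟩ₜ = t`).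
Itô (1944); Revuz–Yor, *Continuous Martingales and Brownian Motion* (1999), Ch. IV,
Thm (2.2), Def. (2.9), Prop. (2.13). [cite: Ito1944] -/
def IsItoIntegral (H B J : ℝ≥0 → Ω → ℝ) (𝓕 : Filtration ℝ≥0 m) (P : Measure Ω) : Prop :=
  (∀ ω, J 0 ω = 0) ∧ (∀ᵐ ω ∂P, Continuous (J · ω)) ∧ RandomPlanarGeometry.IsLocalMartingale J 𝓕 P ∧
    (∃ Hn : ℕ → SimpleProcess m 𝓕, SimpleProcess.IsApproxSeq Hn H P) ∧
    ∀ Hn : ℕ → SimpleProcess m 𝓕, SimpleProcess.IsApproxSeq Hn H P →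
      TendstoUCP (fun n ↦ (Hn n).integral B) J P

section API

variable {H B J J' : ℝ≥0 → Ω → ℝ} {𝓕 : Filtration ℝ≥0 m} {P : Measure Ω}

/-- An Itô integral vanishes at time `0` (by definition).
Revuz–Yor, *Continuous Martingales and Brownian Motion* (1999), Ch. IV, Thm (2.2). [folklore] -/
theorem IsItoIntegral.apply_zero (h : IsItoIntegral H B J 𝓕 P) (ω : Ω) : J 0 ω = 0 :=
  h.1 ω

/-- An Itô integral has a.s. continuous paths (by definition).
Revuz–Yor, *Continuous Martingales and Brownian Motion* (1999), Ch. IV, Thm (2.2). [folklore] -/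
theorem IsItoIntegral.continuous (h : IsItoIntegral H B J 𝓕 P) :
    ∀ᵐ ω ∂P, Continuous (J · ω) :=
  h.2.1

/-- An Itô integral is a local martingale (by definition).
Revuz–Yor, *Continuous Martingales and Brownian Motion* (1999), Ch. IV, Thm (2.2) and
Prop. (2.10). [folklore] -/
theorem IsItoIntegral.isLocalMartingale (h : IsItoIntegral H B J 𝓕 P) :
    RandomPlanarGeometry.IsLocalMartingale J 𝓕 P :=
  h.2.2.1

/-- **Uniqueness of the Itô integral** up to indistinguishability: two Itô integrals of the
same integrand against the same integrator agree at all times outside a `P`-null set (both are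
u.c.p. limits along a common approximating sequence, and both are a.s. continuous).
Revuz–Yor, *Continuous Martingales and Brownian Motion* (1999), Ch. IV, Thm (2.2)
(uniqueness) and Prop. (2.13). [cite: RevuzYor1999, Ch. IV Thm. (2.2)] -/
def IsItoIntegral.unique : Prop :=
  ∀ (h : IsItoIntegral H B J 𝓕 P) (h' : IsItoIntegral H B J' 𝓕 P),
    ∀ᵐ ω ∂P, ∀ t, J t ω = J' t ω

/-- **Uniqueness of the Itô integral holds** (discharge of `IsItoIntegral.unique`). Both `J` and
`J'` are u.c.p. limits of the elementary integrals along one common approximating sequence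
(whose existence is part of `IsItoIntegral`), so for every `t` and `ε > 0` the event
`{∃ s ≤ t, ε ≤ |J s - J' s|}` is contained in the union of two events of probability tending to
`0`, hence is null; the exceptional set is a countable union of such events. No path continuity
and no measurability is needed (measures are outer measures on arbitrary sets).
Revuz–Yor, *Continuous Martingales and Brownian Motion* (1999), Ch. IV, Thm (2.2) (p. 128,
uniqueness of `K·M`) and Prop. (2.13) (p. 133). [cite: RevuzYor1999, Ch. IV Thm. (2.2)] -/
theorem IsItoIntegral.unique_holds :
    IsItoIntegral.unique (H := H) (B := B) (J := J) (J' := J') (𝓕 := 𝓕) (P := P) := by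
  intro h h'
  obtain ⟨Hn, hHn⟩ := h.2.2.2.1
  have hJ := h.2.2.2.2 Hn hHn
  have hJ' := h'.2.2.2.2 Hn hHn
  -- Step 1: for fixed `t` and `ε > 0`, the deviation event is null.
  have key : ∀ (t : ℝ≥0) (ε : ℝ), 0 < ε → P {ω | ∃ s ≤ t, ε ≤ |J s ω - J' s ω|} = 0 := by
    intro t ε hε
    have hε2 : 0 < ε / 2 := by positivity
    have hle : ∀ n, P {ω | ∃ s ≤ t, ε ≤ |J s ω - J' s ω|} ≤
        P {ω | ∃ s ≤ t, ε / 2 ≤ |(Hn n).integral B s ω - J s ω|} +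
          P {ω | ∃ s ≤ t, ε / 2 ≤ |(Hn n).integral B s ω - J' s ω|} := by
      intro n
      refine (measure_mono ?_).trans (measure_union_le _ _)
      rintro ω ⟨s, hs, hεs⟩
      by_contra hcon
      simp only [Set.mem_union, Set.mem_setOf_eq, not_or, not_exists, not_and, not_le] at hcon
      have h1 := hcon.1 s hs
      have h2 := hcon.2 s hs
      have h3 : |J s ω - J' s ω| ≤
          |(Hn n).integral B s ω - J s ω| + |(Hn n).integral B s ω - J' s ω| := by
        calc |J s ω - J' s ω|
            = |((Hn n).integral B s ω - J' s ω) - ((Hn n).integral B s ω - J s ω)| := by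
              ring_nf
          _ ≤ |(Hn n).integral B s ω - J' s ω| + |(Hn n).integral B s ω - J s ω| :=
              abs_sub _ _
          _ = _ := add_comm _ _
      linarith
    have hlim : Tendsto (fun n ↦
        P {ω | ∃ s ≤ t, ε / 2 ≤ |(Hn n).integral B s ω - J s ω|} +
          P {ω | ∃ s ≤ t, ε / 2 ≤ |(Hn n).integral B s ω - J' s ω|}) atTop (𝓝 0) := by
      simpa using (hJ t (ε / 2) hε2).add (hJ' t (ε / 2) hε2)
    exact le_antisymm (ge_of_tendsto hlim (Eventually.of_forall hle)) bot_le
  -- Step 2: the exceptional set is a countable union of such events.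
  have hsub : {ω | ¬ ∀ t, J t ω = J' t ω} ⊆
      ⋃ T : ℕ, ⋃ k : ℕ, {ω | ∃ s ≤ (T : ℝ≥0), 1 / ((k : ℝ) + 1) ≤ |J s ω - J' s ω|} := by
    intro ω hω
    simp only [Set.mem_setOf_eq, not_forall] at hω
    obtain ⟨t, ht⟩ := hω
    obtain ⟨T, hT⟩ := exists_nat_ge t
    have hpos : 0 < |J t ω - J' t ω| := abs_pos.2 (sub_ne_zero.2 ht)
    obtain ⟨k, hk⟩ := exists_nat_one_div_lt hpos
    simp only [Set.mem_iUnion, Set.mem_setOf_eq]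
    exact ⟨T, k, t, hT, hk.le⟩
  rw [ae_iff]
  exact measure_mono_null hsub <| (measure_iUnion_null_iff).2 fun T ↦
    (measure_iUnion_null_iff).2 fun k ↦ key _ _ (by positivity)

end API

/-! ### Itô calculus for the canonical Brownian motion -/

section Brownian

/-- **Itô isometry for simple integrands**: for a bounded simple process `H` adapted to the
Brownian filtration, `E[(H · B)ₜ²] = E[∫₀ᵗ H(s)² ds]` under the pre-Wiener measure.
Itô (1944); Revuz–Yor, *Continuous Martingales and Brownian Motion* (1999), Ch. IV, (2.4)–(2.5)
('?'). [cite: Ito1944] -/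
def itoIsometry_simple : Prop :=
  ∀ (H : SimpleProcess _ RandomPlanarGeometry.brownianFiltration) (t : ℝ≥0),
    ∫ ω, (H.integral brownian t ω) ^ 2 ∂preWienerMeasure =
      ∫ ω, (∫ s in Set.Icc (0 : ℝ) t, (H.toProcess s.toNNReal ω) ^ 2) ∂preWienerMeasure

/-- **Existence of the Itô integral**: every integrand `H` which is progressively measurable
for the Brownian filtration and satisfies `∫₀ᵗ H(s)² ds < ∞` a.s. for every `t` admits an Itô
integral `∫₀ H dB` against the canonical Brownian motion, i.e. a process `J` with
`IsItoIntegral H brownian J brownianFiltration preWienerMeasure`.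
Itô (1944); Revuz–Yor, *Continuous Martingales and Brownian Motion* (1999), Ch. IV, Thm (2.2),
Def. (2.9), Prop. (2.13); raw-filtration version, label '?'. [cite: Ito1944] -/
def exists_isItoIntegral : Prop :=
  ∀ {H : ℝ≥0 → (ℝ≥0 → ℝ) → ℝ} (hH : IsStronglyProgressive RandomPlanarGeometry.brownianFiltration H) (hint : ∀ t : ℝ≥0, ∀ᵐ ω ∂preWienerMeasure, IntegrableOn (fun s : ℝ ↦ H s.toNNReal ω ^ 2) (Set.Icc 0 t)),
    ∃ J, IsItoIntegral H brownian J RandomPlanarGeometry.brownianFiltration preWienerMeasure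

/-- **The quadratic variation of Brownian motion is `t`**: `⟨B⟩ₜ = t`, i.e. `Bₜ² - t` is a
(local) martingale for the Brownian filtration. The martingale property of `Bₜ² - t` is the
literature theorem `Literature.Probability.RandomPlanarGeometry.martingale_brownian_sq_sub` (`LocalMartingale.lean`, proof deferred
upstream); it enters here as the explicit hypothesis `hM`, so that this packaging is proved.
Revuz–Yor, *Continuous Martingales and Brownian Motion* (1999), Ch. IV, Prop. (1.14) /
Ch. II, Prop. (1.2)(ii). [folklore] -/
theorem hasQuadraticVariation_brownian
    (hM : Martingale (fun t ω ↦ brownian t ω ^ 2 - (t : ℝ)) RandomPlanarGeometry.brownianFiltration preWienerMeasure) :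
    HasQuadraticVariation brownian (fun t _ ↦ (t : ℝ)) RandomPlanarGeometry.brownianFiltration preWienerMeasure where
  adapted := adapted_const' _ _
  continuous := ae_of_all _ fun _ ↦ NNReal.continuous_coe
  monotone := ae_of_all _ fun _ _ _ h ↦ NNReal.coe_le_coe.2 h
  zero _ := rfl
  isLocalMartingale := hM.isLocalMartingale

/-- **Itô's formula** for the canonical Brownian motion and `f ∈ C²(ℝ)`:
`f(Bₜ) = f(0) + ∫₀ᵗ f'(B_s) dB_s + ½ ∫₀ᵗ f''(B_s) ds` for all `t`, almost surely, where the
stochastic integral is an Itô integral in the sense of `IsItoIntegral` (recall `B₀ = 0`).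
Itô (1944/1951); Revuz–Yor, *Continuous Martingales and Brownian Motion* (1999), Ch. IV,
Thm (3.3). [cite: Ito1944] -/
def ito_formula : Prop :=
  ∀ (f : ℝ → ℝ) (hf : ContDiff ℝ 2 f),
    ∃ J : ℝ≥0 → (ℝ≥0 → ℝ) → ℝ,
      IsItoIntegral (fun t ω ↦ deriv f (brownian t ω)) brownian J RandomPlanarGeometry.brownianFiltration
        preWienerMeasure ∧
      ∀ᵐ ω ∂preWienerMeasure, ∀ t : ℝ≥0,
        f (brownian t ω) = f 0 + J t ω +
          (1 / 2) * ∫ s in Set.Icc (0 : ℝ) t, iteratedDeriv 2 f (brownian s.toNNReal ω)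

end Brownian

/-- **Lévy's characterisation of Brownian motion**: a continuous local martingale `X` with
`X₀ = 0` a.s. and quadratic variation `⟨X⟩ₜ = t` (i.e. `Xₜ² - t` is a local martingale) on a
probability space is a real Brownian motion (`ProbabilityTheory.IsBrownianReal`).
P. Lévy (1948); Revuz–Yor, *Continuous Martingales and Brownian Motion* (1999), Ch. IV,
Thm (3.6). [cite: Levy1948] -/
def levy_characterisation : Prop :=
  ∀ {X : ℝ≥0 → Ω → ℝ} {𝓕 : Filtration ℝ≥0 m} {P : Measure Ω} [IsProbabilityMeasure P] (hX : RandomPlanarGeometry.IsLocalMartingale X 𝓕 P) (h0 : ∀ᵐ ω ∂P, X 0 ω = 0) (hc : ∀ᵐ ω ∂P, Continuous (X · ω)) (hq : HasQuadraticVariation X (fun t _ ↦ (t : ℝ)) 𝓕 P),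
    IsBrownianReal X P

end Literature.Probability.Process
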